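import Literature.ModelTheory.FiniteModelTheory.XorGraphEncoding
import Literature.ModelTheory.FiniteModelTheory.DegreeParitySystem
import HarnessLib

/-!
# The degree-parity system decodes the encoding graphs of 3XOR systems

Topic `Literature/ModelTheory/FiniteModelTheory`; joins `XorGraphEncoding.lean` (the encoding graph
`XVert.xgraph vr b` of a 3XOR system `(vr, b)`) and `DegreeParitySystem.lean` (the degree-parity
system of a finite graph: `∑_{y ∼ z} U_y = 1` at vertices of degree `2`, `= 0` at vertices of degree
`3`). In `xgraph vr b` the twin tags have degree `2`, the active clause vertices degree `3`
(injective scopes), leaves degree `1`, inactive clause vertices degree `0` and value vertices degree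
`≥ 4` (`degree_tw`, `degree_eq_of_active`, …), so the degree-parity system of the encoding graph is
exactly "twin equations + clause equations", and

  **`paritySolvable_xgraph_iff`**: `ParitySolvable (xgraph vr b) ↔ ∃ h, ∀ u, ∑ i, h (vr u i) = b u`.

With `XVert.ckEquiv_xgraph` (the two encodings `X(vr,b) ≡^{C^k} X(vr,0)` on expanders, `b`
unsolvable): solvability of the degree-parity system — a polynomial-time, isomorphism-invariant
property of finite graphs — has unbounded (linear) counting width, the graph form of
Atserias–Bulatov–Dawar's theorem that solvability of linear equations over `𝔽₂` is not definable
in counting logics.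

## References

* A. Atserias, A. Bulatov, A. Dawar, *Affine systems of equations and counting infinitary logic*,
  Theoret. Comput. Sci. 410 (2009), §4–5 [AtseriasBulatovDawar2009].
* A. Atserias, A. Dawar, *Definable inapproximability: new challenges for duplicator*, J. Logic
  Comput. 29 (2019), §3.2, Lemma 3.2, Theorem 3.8 [AtseriasDawar2019].
-/

namespace Literature.ModelTheory.FiniteModelTheory

open Finset Literature.Combinatorics.SimpleGraph

/-! ### Decoding the encoding graphs of 3XOR systems -/

namespace XVert

variable {n m : ℕ} {vr : Fin m → Fin 3 → Fin n} {b : Fin m → ZMod 2} [DecidableRel (xgraph vr b).Adj]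

/-- The neighbourhood of a twin tag. [folklore] -/
theorem neighborFinset_tw (x : Fin n) : (xgraph vr b).neighborFinset (tw x) = {val x 0, val x 1} := by
  ext q
  rw [SimpleGraph.mem_neighborFinset, adj_tw_iff, Finset.mem_insert, Finset.mem_singleton]

/-- **Twin tags have degree two.** [folklore] -/
theorem degree_tw (x : Fin n) : (xgraph vr b).degree (tw x) = 2 := by
  rw [← SimpleGraph.card_neighborFinset_eq_degree, neighborFinset_tw, Finset.card_pair]
  exact fun h => absurd (XVert.val.inj h).2 (by decide)

/-- The neighbourhood of a leaf. [folklore] -/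
theorem neighborFinset_leaf (x : Fin n) (a : ZMod 2) (j : Fin 3) :
    (xgraph vr b).neighborFinset (leaf x a j) = {val x a} := by
  ext q
  rw [SimpleGraph.mem_neighborFinset, adj_leaf_iff, Finset.mem_singleton]

/-- **Leaves have degree one.** [folklore] -/
theorem degree_leaf (x : Fin n) (a : ZMod 2) (j : Fin 3) : (xgraph vr b).degree (leaf x a j) = 1 := by
  rw [← SimpleGraph.card_neighborFinset_eq_degree, neighborFinset_leaf, Finset.card_singleton]

/-- The neighbourhood of a clause vertex: the image of its literals if active, empty otherwise.
[folklore] -/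
theorem neighborFinset_eq (u : Fin m) (ρ : Fin 3 → ZMod 2) :
    (xgraph vr b).neighborFinset (eq u ρ) =
      if (∑ i, ρ i) = b u then univ.image fun i => val (vr u i) (ρ i) else ∅ := by
  ext q
  rw [SimpleGraph.mem_neighborFinset, adj_eq_iff]
  split_ifs with h
  · simp only [h, true_and, Finset.mem_image, Finset.mem_univ]
    exact ⟨fun ⟨i, hi⟩ => ⟨i, hi.symm⟩, fun ⟨i, hi⟩ => ⟨i, hi.symm⟩⟩
  · simp [h]

/-- **An active clause vertex has degree three** (injective scope). [folklore] -/
theorem degree_eq_of_active {u : Fin m} (hvr : Function.Injective (vr u)) {ρ : Fin 3 → ZMod 2}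
    (h : (∑ i, ρ i) = b u) : (xgraph vr b).degree (eq u ρ) = 3 := by
  rw [← SimpleGraph.card_neighborFinset_eq_degree, neighborFinset_eq, if_pos h,
    Finset.card_image_of_injective _ fun i j hij => hvr (XVert.val.inj hij).1]
  simp

/-- **An inactive clause vertex is isolated.** [folklore] -/
theorem degree_eq_of_inactive {u : Fin m} {ρ : Fin 3 → ZMod 2} (h : (∑ i, ρ i) ≠ b u) :
    (xgraph vr b).degree (eq u ρ) = 0 := by
  rw [← SimpleGraph.card_neighborFinset_eq_degree, neighborFinset_eq, if_neg h, Finset.card_empty]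

/-- **Value vertices have degree at least four** (twin tag and three leaves). [folklore] -/
theorem four_le_degree_val (x : Fin n) (a : ZMod 2) : 4 ≤ (xgraph vr b).degree (val x a) := by
  rw [← SimpleGraph.card_neighborFinset_eq_degree]
  have hsub : ({tw x, leaf x a 0, leaf x a 1, leaf x a 2} : Finset (XVert n m)) ⊆
      (xgraph vr b).neighborFinset (val x a) := by
    intro q hq
    rw [SimpleGraph.mem_neighborFinset, adj_val_iff]
    simp only [Finset.mem_insert, Finset.mem_singleton] at hq
    rcases hq with rfl | rfl | rfl | rfl
    · exact Or.inl rfl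
    · exact Or.inr (Or.inl ⟨0, rfl⟩)
    · exact Or.inr (Or.inl ⟨1, rfl⟩)
    · exact Or.inr (Or.inl ⟨2, rfl⟩)
  refine le_trans (le_of_eq ?_) (Finset.card_le_card hsub)
  rw [Finset.card_insert_of_notMem (by simp), Finset.card_insert_of_notMem (by simp),
    Finset.card_pair (by simp)]

/-- **Rôles are read off degrees**: a vertex of degree two is a twin tag, a vertex of degree three
is an active clause vertex (injective scopes). [folklore] -/
theorem eq_tw_of_degree_eq_two (hvr : ∀ u, Function.Injective (vr u)) {z : XVert n m}
    (hz : (xgraph vr b).degree z = 2) : ∃ x, z = tw x := by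
  cases z with
  | val x a => have := four_le_degree_val (vr := vr) (b := b) x a; omega
  | leaf x a j => rw [degree_leaf] at hz; exact absurd hz (by decide)
  | tw x => exact ⟨x, rfl⟩
  | eq u ρ =>
    by_cases h : (∑ i, ρ i) = b u
    · rw [degree_eq_of_active (hvr u) h] at hz; exact absurd hz (by decide)
    · rw [degree_eq_of_inactive h] at hz; exact absurd hz (by decide)

/-- A vertex of degree three is an active clause vertex. [folklore] -/
theorem eq_eq_of_degree_eq_three {z : XVert n m}
    (hz : (xgraph vr b).degree z = 3) : ∃ u ρ, z = eq u ρ ∧ (∑ i, ρ i) = b u := by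
  cases z with
  | val x a => have := four_le_degree_val (vr := vr) (b := b) x a; omega
  | leaf x a j => rw [degree_leaf] at hz; exact absurd hz (by decide)
  | tw x => rw [degree_tw] at hz; exact absurd hz (by decide)
  | eq u ρ =>
    by_cases h : (∑ i, ρ i) = b u
    · exact ⟨u, ρ, rfl, h⟩
    · rw [degree_eq_of_inactive h] at hz; exact absurd hz (by decide)

/-- The sum over the neighbourhood of an active clause vertex. [folklore] -/
theorem sum_neighborFinset_eq {u : Fin m} (hvr : Function.Injective (vr u)) {ρ : Fin 3 → ZMod 2}
    (h : (∑ i, ρ i) = b u) (U : XVert n m → ZMod 2) :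
    ∑ y ∈ (xgraph vr b).neighborFinset (eq u ρ), U y = ∑ i, U (val (vr u i) (ρ i)) := by
  rw [neighborFinset_eq, if_pos h, Finset.sum_image fun i _ j _ hij => hvr (XVert.val.inj hij).1]

/-- The sum over the neighbourhood of a twin tag. [folklore] -/
theorem sum_neighborFinset_tw (x : Fin n) (U : XVert n m → ZMod 2) :
    ∑ y ∈ (xgraph vr b).neighborFinset (tw x), U y = U (val x 0) + U (val x 1) := by
  rw [neighborFinset_tw, Finset.sum_pair]
  exact fun h => absurd (XVert.val.inj h).2 (by decide)

/-- **A satisfying assignment of the 3XOR system solves the degree-parity system of its encoding**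
(the solution `U (val x a) = h x + a`, zero elsewhere). [cite: AtseriasDawar2019, §3.2] -/
theorem exists_isParitySolution_of_sat (hvr : ∀ u, Function.Injective (vr u)) {h : Fin n → ZMod 2}
    (hsol : ∀ u, ∑ i, h (vr u i) = b u) : ∃ U, IsParitySolution (xgraph vr b) U := by
  refine ⟨fun p => match p with | val x a => h x + a | _ => 0, fun z => ⟨fun hz => ?_, fun hz => ?_⟩⟩
  · obtain ⟨x, rfl⟩ := eq_tw_of_degree_eq_two hvr hz
    rw [sum_neighborFinset_tw]
    show h x + 0 + (h x + 1) = 1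
    rw [add_zero, ← add_assoc, CharTwo.add_self_eq_zero, zero_add]
  · obtain ⟨u, ρ, rfl, hρ⟩ := eq_eq_of_degree_eq_three hz
    rw [sum_neighborFinset_eq (hvr u) hρ]
    show ∑ i, (h (vr u i) + ρ i) = 0
    rw [Finset.sum_add_distrib, hsol u, hρ, CharTwo.add_self_eq_zero]

/-- **A solution of the degree-parity system of the encoding yields a satisfying assignment**:
`x ↦ U (val x 0)`. [cite: AtseriasDawar2019, §3.2] -/
theorem sat_of_isParitySolution (hvr : ∀ u, Function.Injective (vr u)) {U : XVert n m → ZMod 2}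
    (hU : IsParitySolution (xgraph vr b) U) (u : Fin m) : ∑ i, U (val (vr u i) 0) = b u := by
  -- the twin equations: `U (val x a) = U (val x 0) + a`
  have htwin : ∀ (x : Fin n) (a : ZMod 2), U (val x a) = U (val x 0) + a := by
    intro x a
    have h2 := (hU (tw x)).1 (degree_tw x)
    rw [sum_neighborFinset_tw] at h2
    rcases (by decide : ∀ a : ZMod 2, a = 0 ∨ a = 1) a with rfl | rfl
    · rw [add_zero]
    · have := congrArg (fun t => U (val x 0) + t) h2
      simpa only [← add_assoc, CharTwo.add_self_eq_zero, zero_add] using this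
  -- the active copy `ρ₀ = (b u, 0, 0)` of clause `u`
  let ρ₀ : Fin 3 → ZMod 2 := fun i => if i = 0 then b u else 0
  have hρ₀ : (∑ i, ρ₀ i) = b u := by simp [ρ₀]
  have h3 := (hU (eq u ρ₀)).2 (degree_eq_of_active (hvr u) hρ₀)
  rw [sum_neighborFinset_eq (hvr u) hρ₀] at h3
  simp_rw [htwin _ (ρ₀ _), Finset.sum_add_distrib, hρ₀] at h3
  have := congrArg (· + b u) h3
  simpa only [XorHam.add_add_cancel_zmod2, zero_add] using this

/-- **Decoding**: the degree-parity system of the encoding graph `X(vr, b)` is solvable iff the 3XOR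
system `(vr, b)` is satisfiable (injective scopes). In particular it is solvable for `b = 0` and
unsolvable for an unsatisfiable `b`, while `X(vr,b) ≡^{C^k} X(vr,0)` on expanders
(`XVert.ckEquiv_xgraph`): solvability of the degree-parity system has unbounded counting width.
[cite: AtseriasBulatovDawar2009, §5 (via AtseriasDawar2019, Thm 3.8)] -/
theorem paritySolvable_xgraph_iff (hvr : ∀ u, Function.Injective (vr u)) :
    ParitySolvable (xgraph vr b) ↔ ∃ h : Fin n → ZMod 2, ∀ u, ∑ i, h (vr u i) = b u :=
  ⟨fun ⟨U, hU⟩ => ⟨fun x => U (val x 0), sat_of_isParitySolution hvr hU⟩,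
    fun ⟨_, hsol⟩ => exists_isParitySolution_of_sat hvr hsol⟩

/-- The homogeneous encoding is solvable. [folklore] -/
theorem paritySolvable_xgraph_zero (hvr : ∀ u, Function.Injective (vr u))
    [DecidableRel (xgraph vr 0).Adj] : ParitySolvable (xgraph vr 0) :=
  (paritySolvable_xgraph_iff hvr).2 ⟨fun _ => 0, fun u => by simp⟩

end XVert

end Literature.ModelTheory.FiniteModelTheory
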